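import Summits.FinalStateConjecture.FinalStateConjecture.Theorems.ClusterCompletenessOmegaLimitMultiKerrT2Defs
import HarnessLib

/-!
# Route LaminatedThreshold — the Assembly, frame form (item stmt-FinalStateConjecture-16895), factored through the Φ-free core of crux A `LaminatedThreshold` (item stmt-FinalStateConjecture-16893)

The assembly item of the REFUTATION route `LaminatedThreshold` is the curried implication
`LaminatedThreshold → TameExitsLocalise → ¬ FinalStateConjecture`, literally the type of the route file's
sorry-free deciding theorem `closes` and of the route decl
`Summit.FinalStateConjecture.FinalStateConjecture.Theses.LaminatedThreshold.Assembly`; it is proved here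
as `assembly_frame_proof` (last theorem; hypotheses inlined verbatim, so the type is the route decl by
`δ`-unfolding and the route file can import this module without a cycle — the design of
`Theorems/CurvatureOrSymmetryAssemblyFrame.lean`), FACTORED through the Φ-free core of crux A, whose exact
logical position the preceding theorems record.

Crux A of the route
(`Summit.FinalStateConjecture.FinalStateConjecture.Theses.LaminatedThreshold.LaminatedThreshold`; the route's
deciding theorem is `closes : LaminatedThreshold → TameExitsLocalise → ¬ FinalStateConjecture`) asserts: there
are a `3`-manifold `X`, an ADMISSIBLE EXCEPTIONAL vacuum datum `d⋆` (not good in the re-typed sense of the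
summit: an MGHD exists and every MGHD has complete sojourn-`𝓘⁺` and a sub-extremal, ray-closed, exhaustive,
future-oriented Kerr decomposition — `SettlesT2`), a functional `Φ` on data and `K ⊆ ℝ` with `Φ d⋆ ∈ K` a
TWO-SIDED accumulation point of `K`, such that along every jointly smooth one-parameter family `F` through
`d⋆` with admissible members agreeing with `d⋆` off one compact set (a LOCAL family) `Φ ∘ F` is continuous
on a `δ`-ball and every member there with `Φ`-value in `K` is exceptional.

This file records, kernel-checked and WITHOUT importing the route file (every hypothesis is the body of the
route decl inlined, with the summit's per-datum property folded into the landed vocabulary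
`ClusterCompleteness.SettlesT2`, so each type below `δ`-unfolds to `LaminatedThreshold → …`; the route file
may later be re-rendered or the crux restated without breaking this module), the exact logical position of
crux A between the two Φ-free statements it is usually paraphrased by, and what the route's assembly
actually consumes of it:

* `laminatedThreshold_iff_dropBad` — the conjunct "`d⋆` is exceptional" is REDUNDANT: it is the saturation
  clause read along the constant family through `d⋆` (so the crux is `∃ X d⋆ Φ K, admissible ∧ Φ d⋆ ∈ K ∧
  two-sided accumulation ∧ saturation`).
* `laminatedThreshold_of_fatLocal` — the degenerate ("fat") case is included: an admissible datum ALL of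
  whose small local admissible deformations are exceptional witnesses A with `Φ ≡ 0`, `K = univ`.
* `real_lamination` — the lever, as a lemma of real-line topology: a function continuous on `[0, ρ)` whose
  value at `0` is a two-sided accumulation point of `K` takes a value in `K` at some parameter in `(0, ρ)`.
* `exceptional_accumulate_of_laminatedThreshold` — hence the SHARP Φ-free consequence of A: at the witness
  datum, along EVERY local family and in EVERY parameter direction `v ≠ 0`, exceptional members occur at
  parameters `t • v` with `t ∈ (0, ε)` for every `ε > 0` (two-sided accumulation of exceptional members;
  strictly more than "no punctured window of good members").
* `noLocalExitWindow_of_laminatedThreshold` — in particular A implies its Φ-FREE CORE A₀: an admissible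
  exceptional datum through which NO local family has a punctured parameter window `0 < ‖c‖ < ε` of good
  members.
* `not_finalStateConjecture_of_noLocalExitWindow` — and A₀ ALONE already closes the route with crux B
  (`TameExitsLocalise`, inlined verbatim): `A₀ → B → ¬ FinalStateConjecture` in five lines of logic, the
  lamination lemma being needed only to pass from A to A₀. So the load-bearing content of crux A for THIS
  assembly is exactly A₀; the functional `Φ`, the set `K` and the continuity clause encode the route's
  proposed MECHANISM (a Cantor lamination of the collapse threshold) but not additional assembly strength.

Truth status (prover census, 2026-08-17): A, A₀ and "fat" all assert the EXISTENCE of a smooth, complete,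
one-ended asymptotically flat vacuum datum whose maximal developments are PROVED exceptional, robustly under
small compactly supported deformations. No such datum is known: the tree certifies exactly one admissible
datum, the trivial one, and it is GOOD (Minkowski space, `…ChannelsResolveTameDevelopmentsRMinkowskiMaximal`,
given Choquet-Bruhat–Geroch); the rigorous vacuum naked singularities in print (Rodnianski–Shlapentokh-Rothman)
have self-similar data of limited regularity and are conjecturally unstable. Conversely `¬ A` at `Φ ≡ 0` is
local curve-genericity at every exceptional admissible datum — the positive routes' shared hidden lemma,
equally open. Nothing in this file bears on that truth value; it is pure logic plus `real_lamination`.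
References: Christodoulou, CQG 16 (1999) A23, p. A24; Dafermos–Luk, arXiv:1710.01722, Conjecture 1;
Grebogi–McDonald–Ott–Yorke, Phys. Lett. A 99 (1983) 415 (final-state sensitivity, the route's mechanism).
-/

-- every `Summit.FinalStateConjecture.FinalStateConjecture.…` name repeats the summit = sub-problem segment (D-0017 layout)
set_option linter.dupNamespace false

noncomputable section

open scoped Manifold ContDiff Topology
open Set Filter Metric

namespace Summit.FinalStateConjecture.FinalStateConjecture.Theorems.LaminatedThreshold

open Literature.Geometry.Lorentzian
open Summit.FinalStateConjecture.FinalStateConjecture.Theorems.ClusterCompleteness (SettlesT2)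

/-- **The lamination lemma of the real line (the lever).** Let `f : ℝ → ℝ` be continuous on `[0, ρ)` (`ρ > 0`) and let
`f 0` be a two-sided accumulation point of `K ⊆ ℝ` (`K` meets `(f 0 − ε, f 0)` and `(f 0, f 0 + ε)` for
every `ε > 0`). Then `f t ∈ K` for some `t ∈ (0, ρ)`. Indeed, otherwise the connected set `f((0, ρ))`
avoids `K` and accumulates at `f 0`; if it contained a value `≠ f 0` it would contain a whole interval
reaching towards `f 0`, hence a point of `K` — so `f ≡ f 0 ∈ K` on `(0, ρ)`, absurd. This is the body of
the route's deciding theorem `closes`, isolated. [folklore] -/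
theorem real_lamination {f : ℝ → ℝ} {K : Set ℝ} {ρ : ℝ} (hρ : 0 < ρ) (hK : f 0 ∈ K)
    (hacc : ∀ ε : ℝ, 0 < ε →
      (K ∩ Set.Ioo (f 0 - ε) (f 0)).Nonempty ∧ (K ∩ Set.Ioo (f 0) (f 0 + ε)).Nonempty)
    (hcont : ContinuousOn f (Set.Ico 0 ρ)) : ∃ t ∈ Set.Ioo (0 : ℝ) ρ, f t ∈ K := by
  by_contra hno
  push Not at hno
  have hfcont : ContinuousOn f (Set.Ioo 0 ρ) := hcont.mono Set.Ioo_subset_Ico_self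
  have htend : Tendsto f (𝓝[>] 0) (𝓝 (f 0)) := by
    have h0 : ContinuousWithinAt f (Set.Ico 0 ρ) 0 := hcont 0 ⟨le_rfl, hρ⟩
    have h1 : ContinuousWithinAt f (Set.Ioi 0) 0 :=
      h0.mono_of_mem_nhdsWithin (Ico_mem_nhdsGT hρ)
    exact h1.tendsto
  -- the image of the punctured segment is preconnected
  have hpre : IsPreconnected (f '' Set.Ioo 0 ρ) := isPreconnected_Ioo.image f hfcont
  -- every value on the punctured segment equals `f 0`
  have hconst : ∀ t₀ ∈ Set.Ioo (0 : ℝ) ρ, f t₀ = f 0 := by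
    intro t₀ ht₀
    rcases lt_trichotomy (f t₀) (f 0) with hlt | heq | hgt
    · obtain ⟨k₁, hk₁K, hk₁⟩ := (hacc (f 0 - f t₀) (by linarith)).1
      have hk₁lo : f t₀ < k₁ := by have := hk₁.1; linarith
      have hk₁hi : k₁ < f 0 := hk₁.2
      have hev : ∀ᶠ t in 𝓝[>] (0 : ℝ), k₁ < f t ∧ t ∈ Set.Ioo 0 ρ :=
        ((tendsto_order.1 htend).1 k₁ hk₁hi).and (Ioo_mem_nhdsGT hρ)
      obtain ⟨t, hkt, ht⟩ := hev.exists
      have hsub : Set.Icc (f t₀) (f t) ⊆ f '' Set.Ioo 0 ρ :=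
        hpre.Icc_subset (Set.mem_image_of_mem f ht₀) (Set.mem_image_of_mem f ht)
      obtain ⟨t₁, ht₁, hft₁⟩ := hsub ⟨hk₁lo.le, hkt.le⟩
      exact absurd (hft₁ ▸ hk₁K) (hno t₁ ht₁)
    · exact heq
    · obtain ⟨k₁, hk₁K, hk₁⟩ := (hacc (f t₀ - f 0) (by linarith)).2
      have hk₁lo : f 0 < k₁ := hk₁.1
      have hk₁hi : k₁ < f t₀ := by have := hk₁.2; linarith
      have hev : ∀ᶠ t in 𝓝[>] (0 : ℝ), f t < k₁ ∧ t ∈ Set.Ioo 0 ρ :=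
        ((tendsto_order.1 htend).2 k₁ hk₁lo).and (Ioo_mem_nhdsGT hρ)
      obtain ⟨t, hkt, ht⟩ := hev.exists
      have hsub : Set.Icc (f t) (f t₀) ⊆ f '' Set.Ioo 0 ρ :=
        hpre.Icc_subset (Set.mem_image_of_mem f ht) (Set.mem_image_of_mem f ht₀)
      obtain ⟨t₁, ht₁, hft₁⟩ := hsub ⟨hkt.le, hk₁hi.le⟩
      exact absurd (hft₁ ▸ hk₁K) (hno t₁ ht₁)
  have hmid : ρ / 2 ∈ Set.Ioo (0 : ℝ) ρ := ⟨by positivity, by linarith⟩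
  exact hno (ρ / 2) hmid ((hconst (ρ / 2) hmid).symm ▸ hK)

/-! ## The crux and its Φ-free neighbours

Throughout, "`D` is good" is the summit's per-datum property, written with the landed T2 vocabulary:
`(∃ 𝒟 : VacuumCauchyDevelopment D, 𝒟.IsMaximal) ∧ ∀ 𝒟, 𝒟.IsMaximal → SettlesT2 𝒟`
(`ClusterCompleteness.finalStateConjecture_iff_tame` is `Iff.rfl`). A "local family through `d⋆`" is a
jointly smooth `F : ℝ¹ → InitialDataSet (𝓡 3) X` with `F 0 = d⋆`, admissible members, agreeing with `d⋆`
off one compact set — the four hypotheses of the crux's family clause, verbatim. -/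

/-- **The exceptionality conjunct of crux A is redundant**: `LaminatedThreshold` (left, verbatim) is
equivalent to the same statement without "`d⋆` is not good" (right) — along the CONSTANT family through
`d⋆` (jointly smooth, admissible, equal to `d⋆` off `∅`) the saturation clause at the centre `c = 0` of
the `δ`-ball, where `Φ d⋆ ∈ K`, says exactly that `d⋆` is exceptional. [folklore] -/
theorem laminatedThreshold_iff_dropBad :
    (∃ (X : Type) (_ : TopologicalSpace X) (_ : ChartedSpace E3 X) (_ : IsManifold (𝓡 3) ∞ X)
      (_ : T2Space X) (_ : SecondCountableTopology X) (_ : ConnectedSpace X)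
      (dstar : InitialDataSet (𝓡 3) X) (Φ : InitialDataSet (𝓡 3) X → ℝ) (K : Set ℝ),
      dstar ∈ admissibleVacuumData X ∧
      ¬ ((∃ 𝒟 : VacuumCauchyDevelopment dstar, 𝒟.IsMaximal) ∧
          ∀ 𝒟 : VacuumCauchyDevelopment dstar, 𝒟.IsMaximal → SettlesT2 𝒟) ∧
      Φ dstar ∈ K ∧
      (∀ ε : ℝ, 0 < ε →
        (K ∩ Set.Ioo (Φ dstar - ε) (Φ dstar)).Nonempty ∧ (K ∩ Set.Ioo (Φ dstar) (Φ dstar + ε)).Nonempty) ∧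
      ∀ F : EuclideanSpace ℝ (Fin 1) → InitialDataSet (𝓡 3) X,
        InitialDataSet.IsSmoothDataFamily 1 F → F 0 = dstar → (∀ c, F c ∈ admissibleVacuumData X) →
        (∃ C : Set X, IsCompact C ∧
          ∀ c, ∀ x ∉ C, (F c).h.inner x = dstar.h.inner x ∧ (F c).k x = dstar.k x) →
        ∃ δ : ℝ, 0 < δ ∧ ContinuousOn (fun c ↦ Φ (F c)) (Metric.ball 0 δ) ∧
          ∀ c ∈ Metric.ball (0 : EuclideanSpace ℝ (Fin 1)) δ, Φ (F c) ∈ K →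
            ¬ ((∃ 𝒟 : VacuumCauchyDevelopment (F c), 𝒟.IsMaximal) ∧
                ∀ 𝒟 : VacuumCauchyDevelopment (F c), 𝒟.IsMaximal → SettlesT2 𝒟)) ↔
    (∃ (X : Type) (_ : TopologicalSpace X) (_ : ChartedSpace E3 X) (_ : IsManifold (𝓡 3) ∞ X)
      (_ : T2Space X) (_ : SecondCountableTopology X) (_ : ConnectedSpace X)
      (dstar : InitialDataSet (𝓡 3) X) (Φ : InitialDataSet (𝓡 3) X → ℝ) (K : Set ℝ),
      dstar ∈ admissibleVacuumData X ∧
      Φ dstar ∈ K ∧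
      (∀ ε : ℝ, 0 < ε →
        (K ∩ Set.Ioo (Φ dstar - ε) (Φ dstar)).Nonempty ∧ (K ∩ Set.Ioo (Φ dstar) (Φ dstar + ε)).Nonempty) ∧
      ∀ F : EuclideanSpace ℝ (Fin 1) → InitialDataSet (𝓡 3) X,
        InitialDataSet.IsSmoothDataFamily 1 F → F 0 = dstar → (∀ c, F c ∈ admissibleVacuumData X) →
        (∃ C : Set X, IsCompact C ∧
          ∀ c, ∀ x ∉ C, (F c).h.inner x = dstar.h.inner x ∧ (F c).k x = dstar.k x) →
        ∃ δ : ℝ, 0 < δ ∧ ContinuousOn (fun c ↦ Φ (F c)) (Metric.ball 0 δ) ∧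
          ∀ c ∈ Metric.ball (0 : EuclideanSpace ℝ (Fin 1)) δ, Φ (F c) ∈ K →
            ¬ ((∃ 𝒟 : VacuumCauchyDevelopment (F c), 𝒟.IsMaximal) ∧
                ∀ 𝒟 : VacuumCauchyDevelopment (F c), 𝒟.IsMaximal → SettlesT2 𝒟)) := by
  constructor
  · rintro ⟨X, i₁, i₂, i₃, i₄, i₅, i₆, dstar, Φ, K, hD, -, hK, hacc, hsat⟩
    exact ⟨X, i₁, i₂, i₃, i₄, i₅, i₆, dstar, Φ, K, hD, hK, hacc, hsat⟩
  · rintro ⟨X, i₁, i₂, i₃, i₄, i₅, i₆, dstar, Φ, K, hD, hK, hacc, hsat⟩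
    refine ⟨X, i₁, i₂, i₃, i₄, i₅, i₆, dstar, Φ, K, hD, ?_, hK, hacc, hsat⟩
    obtain ⟨δ, hδ, -, hbad⟩ := hsat (fun _ ↦ dstar) (InitialDataSet.isSmoothDataFamily_const 1 dstar)
      rfl (fun _ ↦ hD) ⟨∅, isCompact_empty, fun _ _ _ ↦ ⟨rfl, rfl⟩⟩
    exact hbad 0 (Metric.mem_ball_self hδ) hK

/-- **The fat case is included**: an admissible datum `d⋆` such that along every local family through
`d⋆` ALL members in some parameter ball are exceptional ("locally fat exceptional set") witnesses crux A,
with the constant functional `Φ ≡ 0` and `K = univ` (continuity and accumulation are then trivial and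
saturation is fatness). [folklore] -/
theorem laminatedThreshold_of_fatLocal
    (h : ∃ (X : Type) (_ : TopologicalSpace X) (_ : ChartedSpace E3 X) (_ : IsManifold (𝓡 3) ∞ X)
      (_ : T2Space X) (_ : SecondCountableTopology X) (_ : ConnectedSpace X)
      (dstar : InitialDataSet (𝓡 3) X),
      dstar ∈ admissibleVacuumData X ∧
      ∀ F : EuclideanSpace ℝ (Fin 1) → InitialDataSet (𝓡 3) X,
        InitialDataSet.IsSmoothDataFamily 1 F → F 0 = dstar → (∀ c, F c ∈ admissibleVacuumData X) →
        (∃ C : Set X, IsCompact C ∧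
          ∀ c, ∀ x ∉ C, (F c).h.inner x = dstar.h.inner x ∧ (F c).k x = dstar.k x) →
        ∃ δ : ℝ, 0 < δ ∧ ∀ c ∈ Metric.ball (0 : EuclideanSpace ℝ (Fin 1)) δ,
            ¬ ((∃ 𝒟 : VacuumCauchyDevelopment (F c), 𝒟.IsMaximal) ∧
                ∀ 𝒟 : VacuumCauchyDevelopment (F c), 𝒟.IsMaximal → SettlesT2 𝒟)) :
    ∃ (X : Type) (_ : TopologicalSpace X) (_ : ChartedSpace E3 X) (_ : IsManifold (𝓡 3) ∞ X)
      (_ : T2Space X) (_ : SecondCountableTopology X) (_ : ConnectedSpace X)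
      (dstar : InitialDataSet (𝓡 3) X) (Φ : InitialDataSet (𝓡 3) X → ℝ) (K : Set ℝ),
      dstar ∈ admissibleVacuumData X ∧
      ¬ ((∃ 𝒟 : VacuumCauchyDevelopment dstar, 𝒟.IsMaximal) ∧
          ∀ 𝒟 : VacuumCauchyDevelopment dstar, 𝒟.IsMaximal → SettlesT2 𝒟) ∧
      Φ dstar ∈ K ∧
      (∀ ε : ℝ, 0 < ε →
        (K ∩ Set.Ioo (Φ dstar - ε) (Φ dstar)).Nonempty ∧ (K ∩ Set.Ioo (Φ dstar) (Φ dstar + ε)).Nonempty) ∧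
      ∀ F : EuclideanSpace ℝ (Fin 1) → InitialDataSet (𝓡 3) X,
        InitialDataSet.IsSmoothDataFamily 1 F → F 0 = dstar → (∀ c, F c ∈ admissibleVacuumData X) →
        (∃ C : Set X, IsCompact C ∧
          ∀ c, ∀ x ∉ C, (F c).h.inner x = dstar.h.inner x ∧ (F c).k x = dstar.k x) →
        ∃ δ : ℝ, 0 < δ ∧ ContinuousOn (fun c ↦ Φ (F c)) (Metric.ball 0 δ) ∧
          ∀ c ∈ Metric.ball (0 : EuclideanSpace ℝ (Fin 1)) δ, Φ (F c) ∈ K →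
            ¬ ((∃ 𝒟 : VacuumCauchyDevelopment (F c), 𝒟.IsMaximal) ∧
                ∀ 𝒟 : VacuumCauchyDevelopment (F c), 𝒟.IsMaximal → SettlesT2 𝒟) := by
  obtain ⟨X, i₁, i₂, i₃, i₄, i₅, i₆, dstar, hD, hfat⟩ := h
  refine laminatedThreshold_iff_dropBad.2 ⟨X, i₁, i₂, i₃, i₄, i₅, i₆, dstar, fun _ ↦ 0, Set.univ, hD,
    Set.mem_univ _, fun ε hε ↦ ⟨⟨-(ε / 2), Set.mem_univ _, ?_⟩, ⟨ε / 2, Set.mem_univ _, ?_⟩⟩, ?_⟩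
  · constructor <;> linarith
  · constructor <;> linarith
  intro F hF h0 hadm hC
  obtain ⟨δ, hδ, hbad⟩ := hfat F hF h0 hadm hC
  exact ⟨δ, hδ, continuousOn_const, fun c hc _ ↦ hbad c hc⟩

/-- **Exceptional members accumulate two-sidedly along every local family** (the sharp Φ-free consequence
of crux A): if `LaminatedThreshold` holds (hypothesis, verbatim), then at its witness datum `d⋆` —
admissible and exceptional — every local family `F` through `d⋆` has, in every parameter direction
`v ≠ 0` and for every `ε > 0`, an EXCEPTIONAL member `F (t • v)` with `0 < t < ε`. Proof: saturation
gives `δ`, continuity of `Φ ∘ F` on the `δ`-ball and "`Φ`-value in `K` ⇒ exceptional"; along the ray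
`t ↦ t • v`, `real_lamination` produces `t ∈ (0, min ε (δ/‖v‖))` with `Φ (F (t • v)) ∈ K`. With `v`
and `−v` this is two-sided accumulation of exceptional parameters at `0`; a disprover of crux A may
therefore aim at ONE local family through a candidate `d⋆` with a one-sided punctured window of good
members. [folklore] -/
theorem exceptional_accumulate_of_laminatedThreshold
    (h : ∃ (X : Type) (_ : TopologicalSpace X) (_ : ChartedSpace E3 X) (_ : IsManifold (𝓡 3) ∞ X)
      (_ : T2Space X) (_ : SecondCountableTopology X) (_ : ConnectedSpace X)
      (dstar : InitialDataSet (𝓡 3) X) (Φ : InitialDataSet (𝓡 3) X → ℝ) (K : Set ℝ),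
      dstar ∈ admissibleVacuumData X ∧
      ¬ ((∃ 𝒟 : VacuumCauchyDevelopment dstar, 𝒟.IsMaximal) ∧
          ∀ 𝒟 : VacuumCauchyDevelopment dstar, 𝒟.IsMaximal → SettlesT2 𝒟) ∧
      Φ dstar ∈ K ∧
      (∀ ε : ℝ, 0 < ε →
        (K ∩ Set.Ioo (Φ dstar - ε) (Φ dstar)).Nonempty ∧ (K ∩ Set.Ioo (Φ dstar) (Φ dstar + ε)).Nonempty) ∧
      ∀ F : EuclideanSpace ℝ (Fin 1) → InitialDataSet (𝓡 3) X,
        InitialDataSet.IsSmoothDataFamily 1 F → F 0 = dstar → (∀ c, F c ∈ admissibleVacuumData X) →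
        (∃ C : Set X, IsCompact C ∧
          ∀ c, ∀ x ∉ C, (F c).h.inner x = dstar.h.inner x ∧ (F c).k x = dstar.k x) →
        ∃ δ : ℝ, 0 < δ ∧ ContinuousOn (fun c ↦ Φ (F c)) (Metric.ball 0 δ) ∧
          ∀ c ∈ Metric.ball (0 : EuclideanSpace ℝ (Fin 1)) δ, Φ (F c) ∈ K →
            ¬ ((∃ 𝒟 : VacuumCauchyDevelopment (F c), 𝒟.IsMaximal) ∧
                ∀ 𝒟 : VacuumCauchyDevelopment (F c), 𝒟.IsMaximal → SettlesT2 𝒟)) :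
    ∃ (X : Type) (_ : TopologicalSpace X) (_ : ChartedSpace E3 X) (_ : IsManifold (𝓡 3) ∞ X)
      (_ : T2Space X) (_ : SecondCountableTopology X) (_ : ConnectedSpace X)
      (dstar : InitialDataSet (𝓡 3) X),
      dstar ∈ admissibleVacuumData X ∧
      ¬ ((∃ 𝒟 : VacuumCauchyDevelopment dstar, 𝒟.IsMaximal) ∧
          ∀ 𝒟 : VacuumCauchyDevelopment dstar, 𝒟.IsMaximal → SettlesT2 𝒟) ∧
      ∀ F : EuclideanSpace ℝ (Fin 1) → InitialDataSet (𝓡 3) X,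
        InitialDataSet.IsSmoothDataFamily 1 F → F 0 = dstar → (∀ c, F c ∈ admissibleVacuumData X) →
        (∃ C : Set X, IsCompact C ∧
          ∀ c, ∀ x ∉ C, (F c).h.inner x = dstar.h.inner x ∧ (F c).k x = dstar.k x) →
        ∀ v : EuclideanSpace ℝ (Fin 1), v ≠ 0 → ∀ ε : ℝ, 0 < ε →
          ∃ t ∈ Set.Ioo (0 : ℝ) ε,
            ¬ ((∃ 𝒟 : VacuumCauchyDevelopment (F (t • v)), 𝒟.IsMaximal) ∧
                ∀ 𝒟 : VacuumCauchyDevelopment (F (t • v)), 𝒟.IsMaximal → SettlesT2 𝒟) := by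
  obtain ⟨X, i₁, i₂, i₃, i₄, i₅, i₆, dstar, Φ, K, hD, hbad, hK, hacc, hsat⟩ := h
  refine ⟨X, i₁, i₂, i₃, i₄, i₅, i₆, dstar, hD, hbad, ?_⟩
  intro F hF h0 hadm hC v hv ε hε
  obtain ⟨δ, hδ, hcont, hKsat⟩ := hsat F hF h0 hadm hC
  have hnv : 0 < ‖v‖ := norm_pos_iff.2 hv
  -- the parameter range along the ray `t ↦ t • v` inside the `δ`-ball and inside `(0, ε)`
  set ρ : ℝ := min ε (δ / ‖v‖) with hρ
  have hρpos : 0 < ρ := lt_min hε (div_pos hδ hnv)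
  have hρε : ρ ≤ ε := min_le_left _ _
  have hρδ : ρ ≤ δ / ‖v‖ := min_le_right _ _
  have hball : ∀ t ∈ Set.Ico (0 : ℝ) ρ, t • v ∈ Metric.ball (0 : EuclideanSpace ℝ (Fin 1)) δ := by
    intro t ht
    rw [mem_ball_zero_iff, norm_smul, Real.norm_eq_abs, abs_of_nonneg ht.1]
    calc t * ‖v‖ < ρ * ‖v‖ := mul_lt_mul_of_pos_right ht.2 hnv
      _ ≤ δ / ‖v‖ * ‖v‖ := mul_le_mul_of_nonneg_right hρδ hnv.le
      _ = δ := div_mul_cancel₀ δ hnv.ne'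
  -- the scalar function along the ray
  set f : ℝ → ℝ := fun t ↦ Φ (F (t • v)) with hf
  have hf0 : f 0 = Φ dstar := by simp [hf, h0]
  have hγ : Continuous fun t : ℝ ↦ t • v := continuous_id.smul continuous_const
  have hfcont : ContinuousOn f (Set.Ico 0 ρ) :=
    hcont.comp hγ.continuousOn fun t ht ↦ hball t ht
  have hK' : f 0 ∈ K := by rw [hf0]; exact hK
  have hacc' : ∀ ε : ℝ, 0 < ε →
      (K ∩ Set.Ioo (f 0 - ε) (f 0)).Nonempty ∧ (K ∩ Set.Ioo (f 0) (f 0 + ε)).Nonempty := by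
    rw [hf0]; exact hacc
  obtain ⟨t, ht, htK⟩ := real_lamination hρpos hK' hacc' hfcont
  exact ⟨t, ⟨ht.1, ht.2.trans_le hρε⟩, hKsat (t • v) (hball t ⟨ht.1.le, ht.2⟩) htK⟩

/-- **Crux A implies its Φ-free core A₀ (no local exit window)**: if `LaminatedThreshold` holds
(hypothesis, verbatim), there are `X` and an admissible exceptional datum `d⋆` such that NO local family
through `d⋆` has a punctured parameter window `0 < ‖c‖ < ε` consisting of good members — for every local
family and every `ε > 0` some member `F c`, `c ≠ 0`, `‖c‖ < ε`, is exceptional (take `v = e₀` in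
`exceptional_accumulate_of_laminatedThreshold`). A₀ is what the route's assembly consumes of crux A
(`not_finalStateConjecture_of_noLocalExitWindow`). [folklore] -/
theorem noLocalExitWindow_of_laminatedThreshold
    (h : ∃ (X : Type) (_ : TopologicalSpace X) (_ : ChartedSpace E3 X) (_ : IsManifold (𝓡 3) ∞ X)
      (_ : T2Space X) (_ : SecondCountableTopology X) (_ : ConnectedSpace X)
      (dstar : InitialDataSet (𝓡 3) X) (Φ : InitialDataSet (𝓡 3) X → ℝ) (K : Set ℝ),
      dstar ∈ admissibleVacuumData X ∧
      ¬ ((∃ 𝒟 : VacuumCauchyDevelopment dstar, 𝒟.IsMaximal) ∧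
          ∀ 𝒟 : VacuumCauchyDevelopment dstar, 𝒟.IsMaximal → SettlesT2 𝒟) ∧
      Φ dstar ∈ K ∧
      (∀ ε : ℝ, 0 < ε →
        (K ∩ Set.Ioo (Φ dstar - ε) (Φ dstar)).Nonempty ∧ (K ∩ Set.Ioo (Φ dstar) (Φ dstar + ε)).Nonempty) ∧
      ∀ F : EuclideanSpace ℝ (Fin 1) → InitialDataSet (𝓡 3) X,
        InitialDataSet.IsSmoothDataFamily 1 F → F 0 = dstar → (∀ c, F c ∈ admissibleVacuumData X) →
        (∃ C : Set X, IsCompact C ∧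
          ∀ c, ∀ x ∉ C, (F c).h.inner x = dstar.h.inner x ∧ (F c).k x = dstar.k x) →
        ∃ δ : ℝ, 0 < δ ∧ ContinuousOn (fun c ↦ Φ (F c)) (Metric.ball 0 δ) ∧
          ∀ c ∈ Metric.ball (0 : EuclideanSpace ℝ (Fin 1)) δ, Φ (F c) ∈ K →
            ¬ ((∃ 𝒟 : VacuumCauchyDevelopment (F c), 𝒟.IsMaximal) ∧
                ∀ 𝒟 : VacuumCauchyDevelopment (F c), 𝒟.IsMaximal → SettlesT2 𝒟)) :
    ∃ (X : Type) (_ : TopologicalSpace X) (_ : ChartedSpace E3 X) (_ : IsManifold (𝓡 3) ∞ X)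
      (_ : T2Space X) (_ : SecondCountableTopology X) (_ : ConnectedSpace X)
      (dstar : InitialDataSet (𝓡 3) X),
      dstar ∈ admissibleVacuumData X ∧
      ¬ ((∃ 𝒟 : VacuumCauchyDevelopment dstar, 𝒟.IsMaximal) ∧
          ∀ 𝒟 : VacuumCauchyDevelopment dstar, 𝒟.IsMaximal → SettlesT2 𝒟) ∧
      ∀ F : EuclideanSpace ℝ (Fin 1) → InitialDataSet (𝓡 3) X,
        InitialDataSet.IsSmoothDataFamily 1 F → F 0 = dstar → (∀ c, F c ∈ admissibleVacuumData X) →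
        (∃ C : Set X, IsCompact C ∧
          ∀ c, ∀ x ∉ C, (F c).h.inner x = dstar.h.inner x ∧ (F c).k x = dstar.k x) →
        ∀ ε : ℝ, 0 < ε → ∃ c : EuclideanSpace ℝ (Fin 1), c ≠ 0 ∧ ‖c‖ < ε ∧
          ¬ ((∃ 𝒟 : VacuumCauchyDevelopment (F c), 𝒟.IsMaximal) ∧
              ∀ 𝒟 : VacuumCauchyDevelopment (F c), 𝒟.IsMaximal → SettlesT2 𝒟) := by
  obtain ⟨X, i₁, i₂, i₃, i₄, i₅, i₆, dstar, hD, hbad, hacc⟩ :=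
    exceptional_accumulate_of_laminatedThreshold h
  refine ⟨X, i₁, i₂, i₃, i₄, i₅, i₆, dstar, hD, hbad, ?_⟩
  intro F hF h0 hadm hC ε hε
  set v : EuclideanSpace ℝ (Fin 1) := EuclideanSpace.single (0 : Fin 1) (1 : ℝ) with hv
  have hnv : ‖v‖ = 1 := by simp [hv]
  have hv0 : v ≠ 0 := by
    intro h0v; rw [h0v, norm_zero] at hnv; exact zero_ne_one hnv
  obtain ⟨t, ht, hbadt⟩ := hacc F hF h0 hadm hC v hv0 ε hε
  refine ⟨t • v, smul_ne_zero (ne_of_gt ht.1) hv0, ?_, hbadt⟩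
  rw [norm_smul, hnv, mul_one, Real.norm_eq_abs, abs_of_pos ht.1]
  exact ht.2

/-- **The Φ-free core A₀ closes the route with crux B, without the lamination lemma**: if some admissible
exceptional datum `d⋆` admits no local exit window (A₀, the conclusion of
`noLocalExitWindow_of_laminatedThreshold`) and tame exits localise (crux B `TameExitsLocalise` of the
route, inlined verbatim: an exceptional admissible datum left by a tame immersed injective admissible
family is left by a local one on a punctured window), then the re-typed `FinalStateConjecture` fails:
the summit at `d⋆` IS a tame exit (`IsTameChristodoulouGeneric … 1` unfolded at `d⋆`), B localises it to
a window `ε`, and A₀ puts an exceptional member inside that window. Hence `closes` factors as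
`LaminatedThreshold → A₀` (`noLocalExitWindow_of_laminatedThreshold`) followed by this theorem, and the
planner may weaken crux A to A₀ without touching crux B. [folklore] -/
theorem not_finalStateConjecture_of_noLocalExitWindow
    (hA₀ : ∃ (X : Type) (_ : TopologicalSpace X) (_ : ChartedSpace E3 X) (_ : IsManifold (𝓡 3) ∞ X)
      (_ : T2Space X) (_ : SecondCountableTopology X) (_ : ConnectedSpace X)
      (dstar : InitialDataSet (𝓡 3) X),
      dstar ∈ admissibleVacuumData X ∧
      ¬ ((∃ 𝒟 : VacuumCauchyDevelopment dstar, 𝒟.IsMaximal) ∧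
          ∀ 𝒟 : VacuumCauchyDevelopment dstar, 𝒟.IsMaximal → SettlesT2 𝒟) ∧
      ∀ F : EuclideanSpace ℝ (Fin 1) → InitialDataSet (𝓡 3) X,
        InitialDataSet.IsSmoothDataFamily 1 F → F 0 = dstar → (∀ c, F c ∈ admissibleVacuumData X) →
        (∃ C : Set X, IsCompact C ∧
          ∀ c, ∀ x ∉ C, (F c).h.inner x = dstar.h.inner x ∧ (F c).k x = dstar.k x) →
        ∀ ε : ℝ, 0 < ε → ∃ c : EuclideanSpace ℝ (Fin 1), c ≠ 0 ∧ ‖c‖ < ε ∧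
          ¬ ((∃ 𝒟 : VacuumCauchyDevelopment (F c), 𝒟.IsMaximal) ∧
              ∀ 𝒟 : VacuumCauchyDevelopment (F c), 𝒟.IsMaximal → SettlesT2 𝒟))
    (hB : ∀ (X : Type) [TopologicalSpace X] [ChartedSpace Literature.Geometry.Lorentzian.E3 X] [IsManifold (𝓡 3) ((⊤ : ℕ∞) : WithTop ℕ∞) X] [T2Space X] [SecondCountableTopology X] [ConnectedSpace X], ∀ dstar ∈ Literature.Geometry.Lorentzian.admissibleVacuumData X, ¬ ((∃ 𝒟 : Literature.Geometry.Lorentzian.VacuumCauchyDevelopment dstar, 𝒟.IsMaximal) ∧ ∀ 𝒟 : Literature.Geometry.Lorentzian.VacuumCauchyDevelopment dstar, 𝒟.IsMaximal → Summit.FinalStateConjecture.HasCompleteNullInfinity 𝒟.toCauchyDevelopment ∧ ∃ (O : Set 𝒟.carrier) (d : Literature.Geometry.Lorentzian.FinalStateDecomposition 𝒟.toSpacetime O 2), (∀ i, Literature.Geometry.Lorentzian.Kerr.IsSubextremal (d.mass i) (d.spin i)) ∧ O = Summit.FinalStateConjecture.exteriorOf 𝒟.toCauchyDevelopment d.charted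 ∧ Summit.FinalStateConjecture.RaysStayInClosure 𝒟.toCauchyDevelopment O ∧ Summit.FinalStateConjecture.HasExhaustiveCharts d ∧ Summit.FinalStateConjecture.IsFutureOriented d) → (∃ (e : Literature.Geometry.Lorentzian.AFEnd X) (F : EuclideanSpace ℝ (Fin 1) → Literature.Geometry.Lorentzian.InitialDataSet (𝓡 3) X), Literature.Geometry.Lorentzian.InitialDataSet.IsTameDataFamily e 1 F ∧ Literature.Geometry.Lorentzian.InitialDataSet.IsImmersedAtZero 1 F ∧ F 0 = dstar ∧ Function.Injective F ∧ (∀ c, F c ∈ Literature.Geometry.Lorentzian.admissibleVacuumData X) ∧ ∀ c, c ≠ 0 → ((∃ 𝒟 : Literature.Geometry.Lorentzian.VacuumCauchyDevelopment (F c), 𝒟.IsMaximal) ∧ ∀ 𝒟 : Literature.Geometry.Lorentzian.VacuumCauchyDevelopment (F c), 𝒟.IsMaximal → Summit.FinalStateConjecture.HasCompleteNullInfinity 𝒟.toCauchyDevelopment ∧ ∃ (O : Set 𝒟.carrier) (d : Literature.Geometry.Lorentzian.FinalStateDecomposition 𝒟.toSpacetime O 2), (∀ i, Literature.Geometry.Lorentzian.Kerr.IsSubextremal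 (d.mass i) (d.spin i)) ∧ O = Summit.FinalStateConjecture.exteriorOf 𝒟.toCauchyDevelopment d.charted ∧ Summit.FinalStateConjecture.RaysStayInClosure 𝒟.toCauchyDevelopment O ∧ Summit.FinalStateConjecture.HasExhaustiveCharts d ∧ Summit.FinalStateConjecture.IsFutureOriented d)) → ∃ F' : EuclideanSpace ℝ (Fin 1) → Literature.Geometry.Lorentzian.InitialDataSet (𝓡 3) X, Literature.Geometry.Lorentzian.InitialDataSet.IsSmoothDataFamily 1 F' ∧ Literature.Geometry.Lorentzian.InitialDataSet.IsImmersedAtZero 1 F' ∧ F' 0 = dstar ∧ Function.Injective F' ∧ (∀ c, F' c ∈ Literature.Geometry.Lorentzian.admissibleVacuumData X) ∧ (∃ C : Set X, IsCompact C ∧ ∀ c, ∀ x ∉ C, (F' c).h.inner x = dstar.h.inner x ∧ (F' c).k x = dstar.k x) ∧ ∃ ε : ℝ, 0 < ε ∧ ∀ c, c ≠ 0 → ‖c‖ < ε → ((∃ 𝒟 : Literature.Geometry.Lorentzian.VacuumCauchyDevelopment (F' c), 𝒟.IsMaximal) ∧ ∀ 𝒟 : Literature.Geometry.Lorentzian.VacuumCauchyDevelopment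 (F' c), 𝒟.IsMaximal → Summit.FinalStateConjecture.HasCompleteNullInfinity 𝒟.toCauchyDevelopment ∧ ∃ (O : Set 𝒟.carrier) (d : Literature.Geometry.Lorentzian.FinalStateDecomposition 𝒟.toSpacetime O 2), (∀ i, Literature.Geometry.Lorentzian.Kerr.IsSubextremal (d.mass i) (d.spin i)) ∧ O = Summit.FinalStateConjecture.exteriorOf 𝒟.toCauchyDevelopment d.charted ∧ Summit.FinalStateConjecture.RaysStayInClosure 𝒟.toCauchyDevelopment O ∧ Summit.FinalStateConjecture.HasExhaustiveCharts d ∧ Summit.FinalStateConjecture.IsFutureOriented d)) :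
    ¬ FinalStateConjecture := by
  obtain ⟨X, i₁, i₂, i₃, i₄, i₅, i₆, dstar, hD, hbad, hnoexit⟩ := hA₀
  intro hFSC
  obtain ⟨e, F, hF, himm, h0, hinj, hadm, hexc⟩ := hFSC X dstar ⟨hD, hbad⟩
  obtain ⟨F', hF', -, h0', -, hadm', hC', ε, hε, hgood⟩ :=
    hB X dstar hD hbad ⟨e, F, hF, himm, h0, hinj, hadm, fun c hc ↦ by
      by_contra hP
      exact hexc c hc ⟨hadm c, hP⟩⟩
  obtain ⟨c, hc0, hcε, hbadc⟩ := hnoexit F' hF' h0' hadm' hC' ε hε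
  exact hbadc (hgood c hc0 hcε)

/-! ## The route's Assembly, frame form (item stmt-FinalStateConjecture-16895) -/

/-- **The Assembly of route `LaminatedThreshold`, frame form**: the curried implication
`LaminatedThreshold → TameExitsLocalise → ¬ FinalStateConjecture`, literally the type of the route file's
deciding theorem `closes` and of the route decl
`Summit.FinalStateConjecture.FinalStateConjecture.Theses.LaminatedThreshold.Assembly` (by `δ`-unfolding: the
two hypotheses below are the bodies of `LaminatedThreshold` and `TameExitsLocalise` copied mechanically from
the route file rev 0, one physical line each, so that this module need not import the route file — the
gate re-renders that file with `import <closing module>`, which a route-importing closing module would turn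
into a cycle; same design as `Theorems/CurvatureOrSymmetryAssemblyFrame.lean`). The proof FACTORS the
route's `closes` through the Φ-free core A₀ of crux A: `noLocalExitWindow_of_laminatedThreshold` (the
lamination lemma) followed by `not_finalStateConjecture_of_noLocalExitWindow` (five lines of logic with
crux B). Pure logic; nothing here bears on the truth of the two cruxes. [folklore] -/
theorem assembly_frame_proof :
    (∃ (X : Type) (_ : TopologicalSpace X) (_ : ChartedSpace Literature.Geometry.Lorentzian.E3 X) (_ : IsManifold (𝓡 3) ((⊤ : ℕ∞) : WithTop ℕ∞) X) (_ : T2Space X) (_ : SecondCountableTopology X) (_ : ConnectedSpace X) (dstar : Literature.Geometry.Lorentzian.InitialDataSet (𝓡 3) X) (Φ : Literature.Geometry.Lorentzian.InitialDataSet (𝓡 3) X → ℝ) (K : Set ℝ), dstar ∈ Literature.Geometry.Lorentzian.admissibleVacuumData X ∧ ¬ ((∃ 𝒟 : Literature.Geometry.Lorentzian.VacuumCauchyDevelopment dstar, 𝒟.IsMaximal) ∧ ∀ 𝒟 : Literature.Geometry.Lorentzian.VacuumCauchyDevelopment dstar, 𝒟.IsMaximal → Summit.FinalStateConjecture.HasCompleteNullInfinity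 𝒟.toCauchyDevelopment ∧ ∃ (O : Set 𝒟.carrier) (d : Literature.Geometry.Lorentzian.FinalStateDecomposition 𝒟.toSpacetime O 2), (∀ i, Literature.Geometry.Lorentzian.Kerr.IsSubextremal (d.mass i) (d.spin i)) ∧ O = Summit.FinalStateConjecture.exteriorOf 𝒟.toCauchyDevelopment d.charted ∧ Summit.FinalStateConjecture.RaysStayInClosure 𝒟.toCauchyDevelopment O ∧ Summit.FinalStateConjecture.HasExhaustiveCharts d ∧ Summit.FinalStateConjecture.IsFutureOriented d) ∧ Φ dstar ∈ K ∧ (∀ ε : ℝ, 0 < ε → (K ∩ Set.Ioo (Φ dstar - ε) (Φ dstar)).Nonempty ∧ (K ∩ Set.Ioo (Φ dstar) (Φ dstar + ε)).Nonempty) ∧ ∀ F : EuclideanSpace ℝ (Fin 1) → Literature.Geometry.Lorentzian.InitialDataSet (𝓡 3) X, Literature.Geometry.Lorentzian.InitialDataSet.IsSmoothDataFamily 1 F → F 0 = dstar → (∀ c, F c ∈ Literature.Geometry.Lorentzian.admissibleVacuumData X) → (∃ C : Set X, IsCompact C ∧ ∀ c, ∀ x ∉ C, (F c).h.inner x = dstar.h.inner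 x ∧ (F c).k x = dstar.k x) → ∃ δ : ℝ, 0 < δ ∧ ContinuousOn (fun c ↦ Φ (F c)) (Metric.ball 0 δ) ∧ ∀ c ∈ Metric.ball (0 : EuclideanSpace ℝ (Fin 1)) δ, Φ (F c) ∈ K → ¬ ((∃ 𝒟 : Literature.Geometry.Lorentzian.VacuumCauchyDevelopment (F c), 𝒟.IsMaximal) ∧ ∀ 𝒟 : Literature.Geometry.Lorentzian.VacuumCauchyDevelopment (F c), 𝒟.IsMaximal → Summit.FinalStateConjecture.HasCompleteNullInfinity 𝒟.toCauchyDevelopment ∧ ∃ (O : Set 𝒟.carrier) (d : Literature.Geometry.Lorentzian.FinalStateDecomposition 𝒟.toSpacetime O 2), (∀ i, Literature.Geometry.Lorentzian.Kerr.IsSubextremal (d.mass i) (d.spin i)) ∧ O = Summit.FinalStateConjecture.exteriorOf 𝒟.toCauchyDevelopment d.charted ∧ Summit.FinalStateConjecture.RaysStayInClosure 𝒟.toCauchyDevelopment O ∧ Summit.FinalStateConjecture.HasExhaustiveCharts d ∧ Summit.FinalStateConjecture.IsFutureOriented d)) →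
    (∀ (X : Type) [TopologicalSpace X] [ChartedSpace Literature.Geometry.Lorentzian.E3 X] [IsManifold (𝓡 3) ((⊤ : ℕ∞) : WithTop ℕ∞) X] [T2Space X] [SecondCountableTopology X] [ConnectedSpace X], ∀ dstar ∈ Literature.Geometry.Lorentzian.admissibleVacuumData X, ¬ ((∃ 𝒟 : Literature.Geometry.Lorentzian.VacuumCauchyDevelopment dstar, 𝒟.IsMaximal) ∧ ∀ 𝒟 : Literature.Geometry.Lorentzian.VacuumCauchyDevelopment dstar, 𝒟.IsMaximal → Summit.FinalStateConjecture.HasCompleteNullInfinity 𝒟.toCauchyDevelopment ∧ ∃ (O : Set 𝒟.carrier) (d : Literature.Geometry.Lorentzian.FinalStateDecomposition 𝒟.toSpacetime O 2), (∀ i, Literature.Geometry.Lorentzian.Kerr.IsSubextremal (d.mass i) (d.spin i)) ∧ O = Summit.FinalStateConjecture.exteriorOf 𝒟.toCauchyDevelopment d.charted ∧ Summit.FinalStateConjecture.RaysStayInClosure 𝒟.toCauchyDevelopment O ∧ Summit.FinalStateConjecture.HasExhaustiveCharts d ∧ Summit.FinalStateConjecture.IsFutureOriented d) → (∃ (e :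 Literature.Geometry.Lorentzian.AFEnd X) (F : EuclideanSpace ℝ (Fin 1) → Literature.Geometry.Lorentzian.InitialDataSet (𝓡 3) X), Literature.Geometry.Lorentzian.InitialDataSet.IsTameDataFamily e 1 F ∧ Literature.Geometry.Lorentzian.InitialDataSet.IsImmersedAtZero 1 F ∧ F 0 = dstar ∧ Function.Injective F ∧ (∀ c, F c ∈ Literature.Geometry.Lorentzian.admissibleVacuumData X) ∧ ∀ c, c ≠ 0 → ((∃ 𝒟 : Literature.Geometry.Lorentzian.VacuumCauchyDevelopment (F c), 𝒟.IsMaximal) ∧ ∀ 𝒟 : Literature.Geometry.Lorentzian.VacuumCauchyDevelopment (F c), 𝒟.IsMaximal → Summit.FinalStateConjecture.HasCompleteNullInfinity 𝒟.toCauchyDevelopment ∧ ∃ (O : Set 𝒟.carrier) (d : Literature.Geometry.Lorentzian.FinalStateDecomposition 𝒟.toSpacetime O 2), (∀ i, Literature.Geometry.Lorentzian.Kerr.IsSubextremal (d.mass i) (d.spin i)) ∧ O = Summit.FinalStateConjecture.exteriorOf 𝒟.toCauchyDevelopment d.charted ∧ Summit.FinalStateConjecture.RaysStayInClosure 𝒟.toCauchyDevelopment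 O ∧ Summit.FinalStateConjecture.HasExhaustiveCharts d ∧ Summit.FinalStateConjecture.IsFutureOriented d)) → ∃ F' : EuclideanSpace ℝ (Fin 1) → Literature.Geometry.Lorentzian.InitialDataSet (𝓡 3) X, Literature.Geometry.Lorentzian.InitialDataSet.IsSmoothDataFamily 1 F' ∧ Literature.Geometry.Lorentzian.InitialDataSet.IsImmersedAtZero 1 F' ∧ F' 0 = dstar ∧ Function.Injective F' ∧ (∀ c, F' c ∈ Literature.Geometry.Lorentzian.admissibleVacuumData X) ∧ (∃ C : Set X, IsCompact C ∧ ∀ c, ∀ x ∉ C, (F' c).h.inner x = dstar.h.inner x ∧ (F' c).k x = dstar.k x) ∧ ∃ ε : ℝ, 0 < ε ∧ ∀ c, c ≠ 0 → ‖c‖ < ε → ((∃ 𝒟 : Literature.Geometry.Lorentzian.VacuumCauchyDevelopment (F' c), 𝒟.IsMaximal) ∧ ∀ 𝒟 : Literature.Geometry.Lorentzian.VacuumCauchyDevelopment (F' c), 𝒟.IsMaximal → Summit.FinalStateConjecture.HasCompleteNullInfinity 𝒟.toCauchyDevelopment ∧ ∃ (O : Set 𝒟.carrier) (d : Literature.Geometry.Lorentzian.FinalStateDecomposition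 𝒟.toSpacetime O 2), (∀ i, Literature.Geometry.Lorentzian.Kerr.IsSubextremal (d.mass i) (d.spin i)) ∧ O = Summit.FinalStateConjecture.exteriorOf 𝒟.toCauchyDevelopment d.charted ∧ Summit.FinalStateConjecture.RaysStayInClosure 𝒟.toCauchyDevelopment O ∧ Summit.FinalStateConjecture.HasExhaustiveCharts d ∧ Summit.FinalStateConjecture.IsFutureOriented d)) →
    ¬ FinalStateConjecture :=
  fun hA hB ↦ not_finalStateConjecture_of_noLocalExitWindow (noLocalExitWindow_of_laminatedThreshold hA) hB

end Summit.FinalStateConjecture.FinalStateConjecture.Theorems.LaminatedThreshold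

end
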